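import Summits.QuantumFields.YangMills.Theorems.FluctuationComparisonRegPrIntLS2BetaResidualGauge
import Mathlib.Analysis.Normed.Module.FiniteDimension
import HarnessLib

/-!
# S2β · seam (b) — (T7a) NEAR-SYMMETRY RIGIDITY AT AN IRREDUCIBLE DATUM and THE RESIDUAL CORRECTION OF A FINE GAUGE TRANSFORMATION

Cell `ym3-torus` (YM ladder rung R3 = continuum `SU(2)` Yang–Mills on the three-torus at fixed lattice data — a RUNG: NOT d = 4, NOT infinite volume,
NOT a mass gap, NOT Clay).  Width seat `ym3-torus-px21` (gen 19), the (T)-chain of LINE g18-1 S2β (✓(T1)–✓(T6), px21 g18).  Crux `stmt-QuantumFields-20520`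
(`…Theses.UnitScaleTilt.FluctuationComparisonRegPrIntL`); `--kind proof --supports stmt-QuantumFields-20520 --as helper`, count-neutral, DEFINITION-FREE
(0 `def`, 0 `instance`, 0 `notation`, 0 `sorry`, default heartbeats).

WHY.  Seam (b) of the (T)-chain: pen 3 ✓`…S2BetaOrbitGrowthOfRegular.orbitGrowth_of_isCritR2_five` ([Balaban1985Variational] (142) with its rate, zero hypotheses at `L ≥ 5`)
bounds `A U − A U₀` below by `c·ℓ⁻²·d(U, u•U₀)²` for a FINE gauge transformation `u` ([Balaban1985RegularSpaces] Thm 2's representative gauge; its (1.29)-restriction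
`RestrictedPrint` constrains AVERAGES of `u`, not its centre values, so `u↓ ≠ 1` in general), while the organ's letters POS∘∕TUBE♭∕GAP♭ measure the distance to the RESIDUAL
orbit of `U₀` (`w↓ = 1`).  ✓px8 `…S2BetaOrbitDistComparison` converts one into the other through a minimiser at the MOVED datum `u↓•V` (letters (E), (Ls) LIP-ARGMIN∘, (Lπ)).
THIS FILE supplies the two kinematic facts that make the conversion DIRECT at an irreducible datum, with no moved-datum minimiser:
* §1 dictionary — `norm_comm_sub_eq_dist1` (`‖s(b₋)V_b − V_b s(b₊)‖ = dist1 ((s•V) b·(V b)⁻¹)`: the gauge defect is a bond COMMUTATOR, LINEAR in `s`),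
  `sum_dist1_sq_gaugeAct_le_of_near_scalar` (a gauge transformation sitewise within `η` of ONE scalar matrix moves every field by `≤ 4·#bonds·η²` in `Σ dist1²`).
* §2 ★★ `exists_near_scalar_of_irr` — NEAR-SYMMETRY RIGIDITY: if the datum's commutant is scalar — IRR(V): `∀ s : sites → M₂(ℂ), (∀ b, s(b₋)·V_b = V_b·s(b₊)) → s = c·𝟙` —
  then `∃ K_V ≥ 0, ∀ s : sites → SU(2), ∃ a ∈ ℂ, ∀ y, ‖s(y) − a·1‖ ≤ K_V·(Σ_b dist1 ((s•V) b·(V b)⁻¹)²)^{1/2}`: a near-symmetry of `V` is sitewise near one scalar.  Pure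
  finite-dimensional linear algebra: the commutator map paired with `s ↦ tr s(x₀)` is injective under IRR, hence anti-Lipschitz (Mathlib `LinearMap.exists_antilipschitzWith`).
  IRR(V) is the linear-algebra face of the CENTRAL-STABILISER stratum of ✓px17 pen 4 `…S2BetaCriticalOrbitUnique.atMostOneCriticalOrbit_of_centralStab_five`
  (token `∀ s, GaugeField.gaugeAct s V = V → s = (fun _ => 1) ∨ s = (fun _ => ⟨-1, neg_one_mem⟩)` — cited, not restated; the bridge «central stabiliser ⇒ IRR» is a 2×2
  *-algebra step NOT typed here).
* §3 `residual_mul_inv_liftTransfTo` — THE RESIDUAL CORRECTION: for a fine `ũ`, `w := ũ·(liftTransfTo (ũ↓))⁻¹` is residual (lit ✓`liftTransfTo`, ✓`descTransf_liftTransfTo`,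
  ✓`residual_of_descTransf_eq_one`); `norm_liftTransfTo_sub_smul_one_le` (the block-constant lift inherits sitewise bounds).
CONSTANTS ARE PER DATUM (existential `K_V`), as POS∘ is.  Consumer: (T7b) `…S2BetaPosCollarAtIrreducible` (POS∘∕TUBE♭ at print's regular minimiser over an irreducible datum ⟸
{IRR(V), (Lπ)_loc}).

HONEST: kinematics ∕ linear algebra over landed letters; nothing of Bałaban's analysis; the reducible stratum (non-central stabiliser: there the same route needs pen 4's lifting
hypothesis made quantitative), (Lπ)_loc, ISOL∘(δ), TUBE-REG∘ (datum-free δ, K-uniform μ), GAP♯∘, GAP♭, EXW∘, S2β, crux 20520 NOT proved; no summit statement is proved by a helper;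
finite-volume ∕ conditional; rung R3 = SU(2) YM₃ on T³ — NOT d = 4, NOT infinite volume, NOT a mass gap, NOT Clay; the Yang–Mills mass gap is NOT proved.  Sorry-free, axioms standard.

References: T. Bałaban, CMP **102** (1985) 277–309 [Balaban1985Variational] ((4) p.278, Thm 1 (8)–(10) p.279, Prop. 7 and (141)–(143) p.299); CMP **98** (1985) 17–51
[Balaban1985Averaging] ((8) p.19, (11)–(13) p.19, (19) p.21); CMP **99** (1985) 75–102 [Balaban1985RegularSpaces] (Thm 2 p.83, (1.29) p.81).
-/

set_option autoImplicit false

noncomputable section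

namespace Summit.QuantumFields.YangMills.Theorems.FluctuationComparisonRegPrIntLS2BetaNearSymmetryRigidity

open Set Filter Topology Function
open scoped Matrix.Norms.L2Operator
open Literature.MathematicalPhysics.QuantumFieldTheory.Balaban1983to89
open Literature.MathematicalPhysics.QuantumFieldTheory.Balaban1983to89.T3ContinuumYM3Torus
open Literature.MathematicalPhysics.QuantumFieldTheory.Balaban1983to89.T3UnitLawDensityEML (ℰp)
open Literature.MathematicalPhysics.QuantumFieldTheory.Balaban1983to89.T3TiltDescent
open Literature.MathematicalPhysics.QuantumFieldTheory.Balaban1983to89.T3PrintedRegularOrbits (descTransf descendTo_gaugeAct liftTransfTo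
  descTransf_liftTransfTo)
open Literature.MathematicalPhysics.QuantumFieldTheory.Balaban1983to89.T4Continuum
open Summit.QuantumFields.YangMills.Theorems.FluctuationComparisonRegPrIntLS2BetaResidualGauge

/-! ## §1 Dictionary: the bond commutator and `dist1` -/

section Dict

variable {P : Params} {j : ℕ}

/-- **THE BOND COMMUTATOR IS THE QUOTIENT DISTANCE**: `‖s(b₋)·V_b − V_b·s(b₊)‖ = dist1 ((s•V) b·(V b)⁻¹)` — right-multiply by the unitary `s(b₊)⁻¹·V_b⁻¹`
(the `L²`-operator norm is unitarily invariant). [cite: Balaban1985Averaging, (8) p.19, (19) p.21] -/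
theorem norm_comm_sub_eq_dist1 (s : Site P j → Matrix.specialUnitaryGroup (Fin 2) ℂ) (V : GaugeField P j (Matrix.specialUnitaryGroup (Fin 2) ℂ))
    (b : PBond P j) :
    ‖(s b.src : Matrix (Fin 2) (Fin 2) ℂ) * (V b : Matrix (Fin 2) (Fin 2) ℂ) - (V b : Matrix (Fin 2) (Fin 2) ℂ) * (s b.tgt : Matrix (Fin 2) (Fin 2) ℂ)‖ =
      dist1 ((GaugeField.gaugeAct s V) b * (V b)⁻¹) := by
  rw [SU2Mean.dist1_eq_norm]
  have hu : (((s b.tgt)⁻¹ * (V b)⁻¹ : Matrix.specialUnitaryGroup (Fin 2) ℂ) : Matrix (Fin 2) (Fin 2) ℂ) ∈ unitary (Matrix (Fin 2) (Fin 2) ℂ) :=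
    ((s b.tgt)⁻¹ * (V b)⁻¹).prop.1
  rw [← CStarRing.norm_mul_mem_unitary _ hu]
  congr 1
  have h1 : ((s b.tgt : Matrix (Fin 2) (Fin 2) ℂ)) * (((s b.tgt)⁻¹ * (V b)⁻¹ : Matrix.specialUnitaryGroup (Fin 2) ℂ) : Matrix (Fin 2) (Fin 2) ℂ) =
      (((V b)⁻¹ : Matrix.specialUnitaryGroup (Fin 2) ℂ) : Matrix (Fin 2) (Fin 2) ℂ) := by
    rw [← Submonoid.coe_mul, mul_inv_cancel_left]
  have h2 : ((V b : Matrix (Fin 2) (Fin 2) ℂ)) * (((V b)⁻¹ : Matrix.specialUnitaryGroup (Fin 2) ℂ) : Matrix (Fin 2) (Fin 2) ℂ) = 1 := by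
    rw [← Submonoid.coe_mul, mul_inv_cancel, OneMemClass.coe_one]
  have h3 : ((GaugeField.gaugeAct s V b * (V b)⁻¹ : Matrix.specialUnitaryGroup (Fin 2) ℂ) : Matrix (Fin 2) (Fin 2) ℂ) =
      (s b.src : Matrix (Fin 2) (Fin 2) ℂ) * (V b : Matrix (Fin 2) (Fin 2) ℂ) *
        (((s b.tgt)⁻¹ * (V b)⁻¹ : Matrix.specialUnitaryGroup (Fin 2) ℂ) : Matrix (Fin 2) (Fin 2) ℂ) := by
    simp only [GaugeField.gaugeAct, Submonoid.coe_mul, mul_assoc]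
  rw [h3, sub_mul, mul_assoc (V b : Matrix (Fin 2) (Fin 2) ℂ), h1, h2]

/-- **A NEAR-SCALAR GAUGE TRANSFORMATION MOVES EVERY FIELD LITTLE**: if `‖k(z) − a·1‖ ≤ η` at every site (one scalar `a ∈ ℂ` for all sites), then
`Σ_ℓ dist1 ((k•X) ℓ·(X ℓ)⁻¹)² ≤ 4·#bonds·η²` for every field `X` (`k(ℓ₋)X − Xk(ℓ₊) = (k(ℓ₋) − a)X − X(k(ℓ₊) − a)`, unitary `X_ℓ`).
[cite: Balaban1985Averaging, (8) p.19, (19) p.21] -/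
theorem sum_dist1_sq_gaugeAct_le_of_near_scalar (k : Site P j → Matrix.specialUnitaryGroup (Fin 2) ℂ) (a : ℂ) {η : ℝ}
    (hk : ∀ z, ‖(k z : Matrix (Fin 2) (Fin 2) ℂ) - a • 1‖ ≤ η) (X : GaugeField P j (Matrix.specialUnitaryGroup (Fin 2) ℂ)) :
    ∑ ℓ : PBond P j, dist1 ((GaugeField.gaugeAct k X) ℓ * (X ℓ)⁻¹) ^ 2 ≤ 4 * (Fintype.card (PBond P j) : ℝ) * η ^ 2 := by
  have hterm : ∀ ℓ : PBond P j, dist1 ((GaugeField.gaugeAct k X) ℓ * (X ℓ)⁻¹) ^ 2 ≤ (2 * η) ^ 2 := by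
    intro ℓ
    refine pow_le_pow_left₀ (GaugeGroup.dist1_nonneg _) ?_ 2
    rw [← norm_comm_sub_eq_dist1]
    have hX : ((X ℓ : Matrix.specialUnitaryGroup (Fin 2) ℂ) : Matrix (Fin 2) (Fin 2) ℂ) ∈ unitary (Matrix (Fin 2) (Fin 2) ℂ) := (X ℓ).prop.1
    have hsplit : (k ℓ.src : Matrix (Fin 2) (Fin 2) ℂ) * (X ℓ : Matrix (Fin 2) (Fin 2) ℂ) - (X ℓ : Matrix (Fin 2) (Fin 2) ℂ) * (k ℓ.tgt : Matrix (Fin 2) (Fin 2) ℂ) =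
        ((k ℓ.src : Matrix (Fin 2) (Fin 2) ℂ) - a • 1) * (X ℓ : Matrix (Fin 2) (Fin 2) ℂ) -
          (X ℓ : Matrix (Fin 2) (Fin 2) ℂ) * ((k ℓ.tgt : Matrix (Fin 2) (Fin 2) ℂ) - a • 1) := by
      rw [sub_mul, mul_sub, Matrix.smul_mul, Matrix.mul_smul, one_mul, mul_one]
      abel
    rw [hsplit]
    calc ‖((k ℓ.src : Matrix (Fin 2) (Fin 2) ℂ) - a • 1) * (X ℓ : Matrix (Fin 2) (Fin 2) ℂ) -
            (X ℓ : Matrix (Fin 2) (Fin 2) ℂ) * ((k ℓ.tgt : Matrix (Fin 2) (Fin 2) ℂ) - a • 1)‖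
        ≤ ‖((k ℓ.src : Matrix (Fin 2) (Fin 2) ℂ) - a • 1) * (X ℓ : Matrix (Fin 2) (Fin 2) ℂ)‖ +
            ‖(X ℓ : Matrix (Fin 2) (Fin 2) ℂ) * ((k ℓ.tgt : Matrix (Fin 2) (Fin 2) ℂ) - a • 1)‖ := norm_sub_le _ _
      _ = ‖(k ℓ.src : Matrix (Fin 2) (Fin 2) ℂ) - a • 1‖ + ‖(k ℓ.tgt : Matrix (Fin 2) (Fin 2) ℂ) - a • 1‖ := by
          rw [CStarRing.norm_mul_mem_unitary _ hX, CStarRing.norm_mem_unitary_mul _ hX]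
      _ ≤ η + η := add_le_add (hk _) (hk _)
      _ = 2 * η := by ring
  calc ∑ ℓ : PBond P j, dist1 ((GaugeField.gaugeAct k X) ℓ * (X ℓ)⁻¹) ^ 2
      ≤ ∑ _ℓ : PBond P j, (2 * η) ^ 2 := Finset.sum_le_sum fun ℓ _ => hterm ℓ
    _ = 4 * (Fintype.card (PBond P j) : ℝ) * η ^ 2 := by
        rw [Finset.sum_const, Finset.card_univ, nsmul_eq_mul]; ring

end Dict

/-! ## §2 Near-symmetry rigidity at an irreducible datum (finite-dimensional linear algebra) -/

section Rigidity

variable (F : T3Family) {J : ℕ}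

/-- ★★ **NEAR-SYMMETRY RIGIDITY AT AN IRREDUCIBLE DATUM.**  If the commutant of the datum `V` is scalar — IRR(V): every `s : sites → M₂(ℂ)` with `s(b₋)V_b = V_b s(b₊)`
for all bonds is `c·𝟙` — then there is `K_V ≥ 0` such that EVERY coarse gauge transformation `s` is, at every site, within `K_V·d_J(s•V, V)` of ONE scalar matrix `a·1`:
`‖s(y) − a·1‖ ≤ K_V·(Σ_b dist1 ((s•V) b·(V b)⁻¹)²)^{1/2}`.  Proof: the bond map `s ↦ (s(b₋)V_b − V_b s(b₊))_b` paired with `s ↦ tr s(x₀)` is an injective ℂ-linear map on the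
finite-dimensional space `sites → M₂(ℂ)` (IRR), hence anti-Lipschitz (Mathlib `LinearMap.exists_antilipschitzWith`); apply it to `s − ½tr s(x₀)·𝟙`.  Constants per datum, existential.
[cite: Balaban1985Variational, (4) p.278, Prop. 7 p.299; Balaban1985Averaging, (8) p.19] -/
theorem exists_near_scalar_of_irr (V : GaugeField (F.P J) 0 (Matrix.specialUnitaryGroup (Fin 2) ℂ))
    (hirr : ∀ s : Site (F.P J) 0 → Matrix (Fin 2) (Fin 2) ℂ,
      (∀ b : PBond (F.P J) 0, s b.src * (V b : Matrix (Fin 2) (Fin 2) ℂ) = (V b : Matrix (Fin 2) (Fin 2) ℂ) * s b.tgt) →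
        ∃ c : ℂ, ∀ x, s x = c • (1 : Matrix (Fin 2) (Fin 2) ℂ)) :
    ∃ KV : ℝ, 0 ≤ KV ∧ ∀ s : Site (F.P J) 0 → Matrix.specialUnitaryGroup (Fin 2) ℂ, ∃ a : ℂ,
      ∀ y, ‖(s y : Matrix (Fin 2) (Fin 2) ℂ) - a • 1‖ ≤
        KV * Real.sqrt (∑ b : PBond (F.P J) 0, dist1 ((GaugeField.gaugeAct s V) b * (V b)⁻¹) ^ 2) := by
  classical
  obtain ⟨x₀⟩ : Nonempty (Site (F.P J) 0) := ⟨default⟩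
  -- the linear map `s ↦ ((s(b₋)V_b − V_b s(b₊))_b, tr s(x₀))`
  let T : (Site (F.P J) 0 → Matrix (Fin 2) (Fin 2) ℂ) →ₗ[ℂ] (PBond (F.P J) 0 → Matrix (Fin 2) (Fin 2) ℂ) × ℂ :=
    { toFun := fun s => (fun b => s b.src * (V b : Matrix (Fin 2) (Fin 2) ℂ) - (V b : Matrix (Fin 2) (Fin 2) ℂ) * s b.tgt, Matrix.trace (s x₀))
      map_add' := fun s t => by
        refine Prod.ext (funext fun b => ?_) ?_
        · simp only [Pi.add_apply, add_mul, mul_add, Prod.fst_add]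
          abel
        · simp only [Pi.add_apply, Matrix.trace_add, Prod.snd_add]
      map_smul' := fun c s => by
        refine Prod.ext (funext fun b => ?_) ?_
        · simp only [Pi.smul_apply, Matrix.smul_mul, Matrix.mul_smul, smul_sub, RingHom.id_apply, Prod.smul_fst]
        · simp only [Pi.smul_apply, Matrix.trace_smul, RingHom.id_apply, Prod.smul_snd] }
  have hT : ∀ s : Site (F.P J) 0 → Matrix (Fin 2) (Fin 2) ℂ,
      T s = (fun b => s b.src * (V b : Matrix (Fin 2) (Fin 2) ℂ) - (V b : Matrix (Fin 2) (Fin 2) ℂ) * s b.tgt, Matrix.trace (s x₀)) := fun _ => rfl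
  -- injective under IRR
  have hker : LinearMap.ker T = ⊥ := by
    refine LinearMap.ker_eq_bot'.mpr fun s hs => ?_
    rw [hT] at hs
    have h1 : ∀ b : PBond (F.P J) 0, s b.src * (V b : Matrix (Fin 2) (Fin 2) ℂ) = (V b : Matrix (Fin 2) (Fin 2) ℂ) * s b.tgt := by
      intro b
      have := congrFun (congrArg Prod.fst hs) b
      exact sub_eq_zero.mp this
    have h2 : Matrix.trace (s x₀) = 0 := congrArg Prod.snd hs
    obtain ⟨c, hc⟩ := hirr s h1
    have hc0 : c = 0 := by
      rw [hc x₀, Matrix.trace_smul, Matrix.trace_one, Fintype.card_fin] at h2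
      norm_num at h2
      exact h2
    funext x
    rw [hc x, hc0, zero_smul, Pi.zero_apply]
  obtain ⟨Kc, _hKc, hanti⟩ := T.exists_antilipschitzWith hker
  refine ⟨Kc, Kc.coe_nonneg, fun s => ?_⟩
  -- the scalar: `a = ½ tr s(x₀)`
  refine ⟨Matrix.trace ((s x₀ : Matrix.specialUnitaryGroup (Fin 2) ℂ) : Matrix (Fin 2) (Fin 2) ℂ) / 2, fun y => ?_⟩
  set a : ℂ := Matrix.trace ((s x₀ : Matrix.specialUnitaryGroup (Fin 2) ℂ) : Matrix (Fin 2) (Fin 2) ℂ) / 2 with ha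
  set e : Site (F.P J) 0 → Matrix (Fin 2) (Fin 2) ℂ := fun y => (s y : Matrix (Fin 2) (Fin 2) ℂ) - a • 1 with he
  set S : ℝ := ∑ b : PBond (F.P J) 0, dist1 ((GaugeField.gaugeAct s V) b * (V b)⁻¹) ^ 2 with hS
  -- `T e = ((s(b₋)V_b − V_b s(b₊))_b, 0)`
  have hTe1 : ∀ b : PBond (F.P J) 0, (T e).1 b = (s b.src : Matrix (Fin 2) (Fin 2) ℂ) * (V b : Matrix (Fin 2) (Fin 2) ℂ) -
      (V b : Matrix (Fin 2) (Fin 2) ℂ) * (s b.tgt : Matrix (Fin 2) (Fin 2) ℂ) := by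
    intro b
    rw [hT]
    show e b.src * (V b : Matrix (Fin 2) (Fin 2) ℂ) - (V b : Matrix (Fin 2) (Fin 2) ℂ) * e b.tgt = _
    simp only [he, sub_mul, mul_sub, Matrix.smul_mul, Matrix.mul_smul, one_mul, mul_one]
    abel
  have hTe2 : (T e).2 = 0 := by
    rw [hT]
    show Matrix.trace (e x₀) = 0
    simp only [he, Matrix.trace_sub, Matrix.trace_smul, Matrix.trace_one, Fintype.card_fin, ha]
    norm_num
  -- `‖T e‖ ≤ √S`
  have hTe : ‖T e‖ ≤ Real.sqrt S := by
    rw [Prod.norm_def, hTe2, norm_zero, max_eq_left (norm_nonneg _)]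
    refine (pi_norm_le_iff_of_nonneg (Real.sqrt_nonneg _)).mpr fun b => ?_
    rw [hTe1, norm_comm_sub_eq_dist1]
    refine Real.le_sqrt_of_sq_le ?_
    rw [hS]
    exact Finset.single_le_sum (f := fun b => dist1 ((GaugeField.gaugeAct s V) b * (V b)⁻¹) ^ 2) (fun b _ => sq_nonneg _) (Finset.mem_univ b)
  -- anti-Lipschitz
  have h1 : ‖e‖ ≤ Kc * ‖T e‖ := by
    have h := hanti.le_mul_dist e 0
    rwa [dist_zero_right, map_zero, dist_zero_right] at h
  calc ‖(s y : Matrix (Fin 2) (Fin 2) ℂ) - a • 1‖ = ‖e y‖ := rfl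
    _ ≤ ‖e‖ := norm_le_pi_norm e y
    _ ≤ Kc * ‖T e‖ := h1
    _ ≤ Kc * Real.sqrt S := mul_le_mul_of_nonneg_left hTe Kc.coe_nonneg

end Rigidity

/-! ## §3 The residual correction of a fine gauge transformation -/

section Lift

variable (F : T3Family) {J K : ℕ} (hJK : J ≤ K)

/-- **THE RESIDUAL CORRECTION**: for a fine gauge transformation `ũ`, with `k := liftTransfTo (ũ↓)` (the block-constant lift of its descent, lit ✓`liftTransfTo`,
`(liftTransfTo s)↓ = s`), the transformation `w := ũ·k⁻¹` is RESIDUAL (`w↓ = ũ↓·(ũ↓)⁻¹ = 1`, ✓`residual_of_descTransf_eq_one`).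
[cite: Balaban1985Averaging, (11)-(13) p.19; Balaban1985Variational, (4) p.278] -/
theorem residual_mul_inv_liftTransfTo (ũ : Site (F.P K) 0 → Matrix.specialUnitaryGroup (Fin 2) ℂ) :
    ∀ U'' : GaugeField (F.P K) 0 (Matrix.specialUnitaryGroup (Fin 2) ℂ),
      descendTo F ℰp J K hJK (GaugeField.gaugeAct (fun x => ũ x * (liftTransfTo F J K hJK (descTransf F J K hJK ũ) x)⁻¹) U'') =
        descendTo F ℰp J K hJK U'' := by
  refine residual_of_descTransf_eq_one F hJK ?_
  have hmul : ∀ (u k : GaugeTransf (F.P K) 0 (Matrix.specialUnitaryGroup (Fin 2) ℂ)) (i : ℕ) (y : Site (F.P K) i),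
      transfUp (fun x => u x * (k x)⁻¹) i y = transfUp u i y * (transfUp k i y)⁻¹ := by
    intro u k i
    induction i with
    | zero => intro y; rfl
    | succ i ih => intro y; exact ih _
  funext y
  have h1 : descTransf F J K hJK (fun x => ũ x * (liftTransfTo F J K hJK (descTransf F J K hJK ũ) x)⁻¹) y =
      descTransf F J K hJK ũ y * (descTransf F J K hJK (liftTransfTo F J K hJK (descTransf F J K hJK ũ)) y)⁻¹ := hmul _ _ _ _
  rw [h1, descTransf_liftTransfTo, mul_inv_cancel]

/-- The block-constant lift inherits every sitewise bound of the coarse transformation: `‖(liftTransfTo s)(z) − a·1‖ ≤ η` if `‖s(y) − a·1‖ ≤ η` for all `y`.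
[cite: Balaban1985Averaging, (12) p.19] -/
theorem norm_liftTransfTo_sub_smul_one_le (s : Site (F.P J) 0 → Matrix.specialUnitaryGroup (Fin 2) ℂ) (a : ℂ) {η : ℝ}
    (hs : ∀ y, ‖(s y : Matrix (Fin 2) (Fin 2) ℂ) - a • 1‖ ≤ η) (z : Site (F.P K) 0) :
    ‖((liftTransfTo F J K hJK s z : Matrix.specialUnitaryGroup (Fin 2) ℂ) : Matrix (Fin 2) (Fin 2) ℂ) - a • 1‖ ≤ η :=
  hs _

end Lift

end Summit.QuantumFields.YangMills.Theorems.FluctuationComparisonRegPrIntLS2BetaNearSymmetryRigidity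

end
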